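import Mathlib.RingTheory.MvPolynomial.Basic
import Mathlib.Algebra.MvPolynomial.CommRing
import Mathlib.Algebra.MvPolynomial.Degrees
import Literature.Computability.Complexity.CNF
import Literature.Computability.Complexity.CardinalityCNF
import Literature.Computability.Complexity.NullstellensatzRefutation
import HarnessLib

/-!
# The polynomial translation of CNFs and their Nullstellensatz degree

Definitions (real, with bodies; no named facts) of the standard translation of clauses and CNFs
into polynomial equations, after Krajíček, *Proof Complexity* (CUP 2019), §6 display (6.0.1), and
Beame–Impagliazzo–Krajíček–Pitassi–Pudlák (Proc. LMS 1996, §1 and §5: the Nullstellensatz system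
on the translation of a CNF together with the Boolean axioms):

* `Literal.falsePoly K l` — the `0/1` arithmetisation of the FALSITY of a literal:
  a positive literal `x_v` (the pair `(v, true)`) ↦ `1 - X v`, a negative literal `¬ x_v`
  (`(v, false)`) ↦ `X v`;
* `Clause.toPoly K C = ∏_{l ∈ C} Literal.falsePoly K l` — Krajíček's `tr(C)` (6.0.1): at a Boolean
  point it is `1` iff the clause is falsified and `0` otherwise (`Clause.eval_toPoly`);
* `boolAxiom K v = X v ^ 2 - X v` — the Boolean axiom of the variable `v`;
* `CNF.nsFamily K φ : Fin φ.length ⊕ ν → K[ν]` — the polynomial system of a CNF `φ`: its clause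
  polynomials (indexed by position in the list) together with the Boolean axioms of EVERY
  variable of the index type `ν` (extra Boolean axioms for variables not occurring in `φ` change no
  refutation degree: substitute `0` for them);
* `CNF.NSDegreeGE K φ D` — "the Nullstellensatz degree of `φ` over `K` is at least `D`": no
  Nullstellensatz refutation of `φ.nsFamily K` has all its products of total degree `< D`
  (degree convention of `HasNSRefutationOfDegree` = Krajíček §6.2 / BIKPP96: the degree of a
  refutation `∑ g_a 𝒜_a = 1` is `max_a deg (g_a 𝒜_a)`, Boolean axioms included).

API (proved): values at Boolean points (`Literal.eval_falsePoly`, `Clause.eval_toPoly`,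
`eval_boolAxiom`), degree of a clause polynomial (`Clause.totalDegree_toPoly_le`), monotonicity of
`NSDegreeGE`, and SOUNDNESS: a satisfiable CNF has no Nullstellensatz refutation of any degree
(`CNF.not_hasNSRefutationOfDegree_of_satisfiable`).

The same translation, specialised, already occurs problem-side (`unsatPolyK`, `cnfPolys` of
`Summits/PneNP/PneNP/Theorems/ExpanderLinearGeneratorsPolyCalcClauses.lean`, field coefficients,
variables `ℕ`) and over `ℝ` in `Literature/Computability/MetaComplexity/SumOfSquares.lean`
(`litFalsePoly`, `unsatPoly`, `boolAxiom`); this file is the coefficient-ring- and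
variable-generic Literature home of the notion (the problem-side `unsatPolyK K C` is
`Clause.toPoly K C` by `rfl`). NOT here: the polynomial calculus (see
`MetaComplexity/PolynomialCalculus.lean`), size measures, twin variables (PCR).

## References

* J. Krajíček, *Proof Complexity*, CUP 2019, §6 (6.0.1), §6.2. [KrajicekProofComplexity2019]
* P. Beame, R. Impagliazzo, J. Krajíček, T. Pitassi, P. Pudlák, *Lower bounds on Hilbert's
  Nullstellensatz and propositional proofs*, Proc. London Math. Soc. 73 (1996) 1–26, §1, §5.
  [BeameImpagliazzoKrajicekPitassiPudlak1996]
-/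

noncomputable section

open MvPolynomial

namespace Literature.Computability.Complexity

universe u

variable {ν : Type u} (K : Type*) [CommRing K]

/-! ### The translation -/

/-- The `0/1`-arithmetisation over `K` of the FALSITY of a literal: the positive literal
`(v, true)` ↦ `1 - X v`, the negative literal `(v, false)` ↦ `X v` (the tree's literal `(v, b)`
is true under `σ` iff `σ v = b`). [cite: KrajicekProofComplexity2019, §6 (6.0.1)] -/
def Literal.falsePoly (l : Literal ν) : MvPolynomial ν K :=
  if l.2 then 1 - X l.1 else X l.1

/-- Krajíček's translation `tr(C)` of a clause: the product of the falsity polynomials of its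
literals, `∏_{x_v ∈ C} (1 - X v) · ∏_{¬x_v ∈ C} X v`; it vanishes at a Boolean point iff the
clause is satisfied there (`Clause.eval_toPoly`). [cite: KrajicekProofComplexity2019, §6 (6.0.1)] -/
def Clause.toPoly (C : Clause ν) : MvPolynomial ν K :=
  (C.map (Literal.falsePoly K)).prod

/-- The Boolean axiom `X v ^ 2 - X v` of the variable `v`.
[cite: KrajicekProofComplexity2019, §6.2] -/
def boolAxiom (v : ν) : MvPolynomial ν K :=
  X v ^ 2 - X v

/-- The polynomial system of a CNF `φ` refuted by Nullstellensatz / polynomial calculus: the clause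
polynomials `tr(C)` (indexed by the position of `C` in `φ`) and the Boolean axioms of every
variable of `ν`. [cite: BeameImpagliazzoKrajicekPitassiPudlak1996, §5] -/
def CNF.nsFamily (φ : CNF ν) : Fin φ.length ⊕ ν → MvPolynomial ν K :=
  Sum.elim (fun a => Clause.toPoly K (φ.get a)) (boolAxiom K)

/-- "The Nullstellensatz degree of `φ` over `K` is at least `D`": `φ.nsFamily K` has no
Nullstellensatz refutation all of whose products `g_a · 𝒜_a` have total degree `< D`
(Krajíček §6.2 degree convention; `D = 0` is vacuous). [cite: KrajicekProofComplexity2019, §6.2] -/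
def CNF.NSDegreeGE (φ : CNF ν) (D : ℕ) : Prop :=
  ∀ d : ℕ, d < D → ¬ HasNSRefutationOfDegree (φ.nsFamily K) d

/-! ### Values at Boolean points -/

/-- The point of `K^ν` with coordinates `0/1` given by a Boolean assignment. [folklore] -/
def boolPoint (σ : ν → Bool) : ν → K :=
  fun v => if σ v then 1 else 0

/-- Coordinates of a Boolean point. [folklore] -/
@[simp] theorem boolPoint_apply (σ : ν → Bool) (v : ν) :
    boolPoint K σ v = if σ v then 1 else 0 := rfl

/-- At a Boolean point the falsity polynomial of a literal is `0` if the literal is true and `1`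
if it is false. [folklore] -/
theorem Literal.eval_falsePoly (σ : ν → Bool) (l : Literal ν) :
    MvPolynomial.eval (boolPoint K σ) (l.falsePoly K) = if l.eval σ then 0 else 1 := by
  rcases l with ⟨v, b⟩
  cases b <;> cases h : σ v <;> simp [Literal.falsePoly, Literal.eval, h]

/-- At a Boolean point `tr(C)` is `0` if the clause is satisfied and `1` if it is falsified.
[cite: KrajicekProofComplexity2019, §6 (6.0.1)] -/
theorem Clause.eval_toPoly (σ : ν → Bool) (C : Clause ν) :
    MvPolynomial.eval (boolPoint K σ) (Clause.toPoly K C) = if Clause.eval σ C then 0 else 1 := by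
  induction C with
  | nil => simp [Clause.toPoly, Clause.eval]
  | cons l C ih =>
    have hC : Clause.toPoly K (l :: C) = l.falsePoly K * Clause.toPoly K C := by
      simp [Clause.toPoly]
    rw [hC, map_mul, ih, Literal.eval_falsePoly, Clause.eval_cons]
    cases Literal.eval σ l <;> cases Clause.eval σ C <;> simp

/-- Boolean axioms vanish at Boolean points. [folklore] -/
@[simp] theorem eval_boolAxiom (σ : ν → Bool) (v : ν) :
    MvPolynomial.eval (boolPoint K σ) (boolAxiom K v) = 0 := by
  cases h : σ v <;> simp [boolAxiom, h]

/-- Every member of `φ.nsFamily K` vanishes at the Boolean point of a satisfying assignment.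
[folklore] -/
theorem CNF.eval_nsFamily_eq_zero {φ : CNF ν} {σ : ν → Bool} (hσ : φ.eval σ = true)
    (a : Fin φ.length ⊕ ν) : MvPolynomial.eval (boolPoint K σ) (φ.nsFamily K a) = 0 := by
  rcases a with a | v
  · have hmem : φ.get a ∈ φ := List.get_mem φ a
    have hall := List.all_eq_true.1 hσ (φ.get a) hmem
    have hc : Clause.eval σ (φ.get a) = true := by simpa [Clause.eval] using hall
    show MvPolynomial.eval (boolPoint K σ) (Clause.toPoly K (φ.get a)) = 0
    rw [Clause.eval_toPoly, if_pos hc]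
  · simp [CNF.nsFamily]

/-! ### Soundness and degree -/

/-- SOUNDNESS: a satisfiable CNF has no Nullstellensatz refutation of any degree (evaluate
`∑ g_a 𝒜_a = 1` at a satisfying Boolean point). [cite: BeameImpagliazzoKrajicekPitassiPudlak1996, §5] -/
theorem CNF.not_hasNSRefutationOfDegree_of_satisfiable [Nontrivial K] {φ : CNF ν}
    (h : φ.Satisfiable) (d : ℕ) : ¬ HasNSRefutationOfDegree (φ.nsFamily K) d := by
  rintro ⟨s, g, hsum, -⟩
  obtain ⟨σ, hσ⟩ := h
  have h1 := congrArg (MvPolynomial.eval (boolPoint K σ)) hsum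
  simp [map_sum, map_mul, CNF.eval_nsFamily_eq_zero K hσ] at h1

/-- Hence a satisfiable CNF has every Nullstellensatz degree lower bound (the predicate is only
interesting for unsatisfiable CNFs). [folklore] -/
theorem CNF.nsDegreeGE_of_satisfiable [Nontrivial K] {φ : CNF ν} (h : φ.Satisfiable) (D : ℕ) :
    φ.NSDegreeGE K D :=
  fun d _ => CNF.not_hasNSRefutationOfDegree_of_satisfiable K h d

/-- `NSDegreeGE` is antitone in the bound. [folklore] -/
theorem CNF.NSDegreeGE.mono {φ : CNF ν} {D D' : ℕ} (h : φ.NSDegreeGE K D) (hD : D' ≤ D) :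
    φ.NSDegreeGE K D' :=
  fun d hd => h d (lt_of_lt_of_le hd hD)

/-- `NSDegreeGE K φ D` iff (for `D = d + 1`) there is no refutation of degree `≤ d`. [folklore] -/
theorem CNF.nsDegreeGE_succ_iff {φ : CNF ν} {d : ℕ} :
    φ.NSDegreeGE K (d + 1) ↔ ¬ HasNSRefutationOfDegree (φ.nsFamily K) d := by
  constructor
  · exact fun h => h d (Nat.lt_succ_self d)
  · intro h d' hd' hd
    exact h (hd.mono (Nat.le_of_lt_succ hd'))

/-- A variable has total degree `≤ 1` (`= 1` unless `K` is trivial). [folklore] -/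
theorem totalDegree_X_le_one (v : ν) : (X v : MvPolynomial ν K).totalDegree ≤ 1 := by
  rcases subsingleton_or_nontrivial K with hK | hK
  · rw [Subsingleton.elim (X v : MvPolynomial ν K) 0]
    simp
  · simp

/-- The falsity polynomial of a literal has total degree `≤ 1`. [folklore] -/
theorem Literal.totalDegree_falsePoly_le (l : Literal ν) :
    (l.falsePoly K).totalDegree ≤ 1 := by
  rcases l with ⟨v, b⟩
  cases b
  · simpa [Literal.falsePoly] using totalDegree_X_le_one K v
  · simp only [Literal.falsePoly, if_true]
    calc ((1 : MvPolynomial ν K) - X v).totalDegree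
        ≤ max (1 : MvPolynomial ν K).totalDegree (X v : MvPolynomial ν K).totalDegree :=
          totalDegree_sub _ _
      _ ≤ 1 := by
          rw [totalDegree_one]
          exact max_le (Nat.zero_le _) (totalDegree_X_le_one K v)

/-- Krajíček's `tr(C)` has total degree at most the width of the clause.
[cite: KrajicekProofComplexity2019, §6 (6.0.1)] -/
theorem Clause.totalDegree_toPoly_le (C : Clause ν) :
    (Clause.toPoly K C).totalDegree ≤ C.length := by
  induction C with
  | nil => simp [Clause.toPoly]
  | cons l C ih =>
    have hC : Clause.toPoly K (l :: C) = l.falsePoly K * Clause.toPoly K C := by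
      simp [Clause.toPoly]
    rw [hC, List.length_cons]
    calc (l.falsePoly K * Clause.toPoly K C).totalDegree
        ≤ (l.falsePoly K).totalDegree + (Clause.toPoly K C).totalDegree := totalDegree_mul _ _
      _ ≤ 1 + C.length := add_le_add (Literal.totalDegree_falsePoly_le K l) ih
      _ = C.length + 1 := add_comm _ _

end Literature.Computability.Complexity
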